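import Summits.Ventures.GridStability.Lyapunov.StructurePreservingPolytope
import Literature.MathematicalPhysics.PowerSystems.PhaseCohesiveEquilibriumUniqueness
import HarnessLib

/-!
# GridStability/Lyapunov/StructurePreservingPolytopeUnique — the structure-preserving energy route on
# Vu–Turitsyn's polytope, part 2: uniqueness of the synchronous equilibrium inside the polytope on its
# momentum leaf, and hypothesis (iii) of Barbashin–Krasovskii

Cell `gridfusion` (LADDER-GRIDFUSION), seat gridfusion-lyap-1 (g6); brief «SP-POLYTOPE» (lead RULING
6i (5) «LFF-NU-SPARSE» as repaired, INBOX 2026-08-27). Part 1 `StructurePreservingPolytope.lean`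
(`vtPolytope`, edge bound, compactness); part 3 `StructurePreservingPolytopeRoa.lean` (assembly).
HERE, for model-2's mixed-order lossless class `StructurePreserving.Params` (well-formed: `Mᵢ > 0` on
`gen`, `= 0` off `gen`, every `Dᵢ > 0` — ANY damping pattern —, `b` symmetric susceptive, preconnected
coupling graph):

* `eq_of_isSyncEquilibrium_of_momentum_eq_vtPolytope` — **inside Vu–Turitsyn's polytope the
  synchronous equilibrium is unique on its momentum leaf**: two synchronous equilibria `δ₀`
  (`|σ*| < π/2` on coupled pairs) and `δ` (`|σ + σ*| < π` on coupled pairs) with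
  `L(δ, 0) = L(δ₀, 0)` coincide. PAIRING identity `0 = Σᵢ φᵢ(fᵢ(δ) − fᵢ(δ₀)) = ½ Σᵢⱼ bᵢⱼ
  (σᵢⱼ − σ*ᵢⱼ)(sin σᵢⱼ − sin σ*ᵢⱼ)` (model-2's `half_sum_sub_mul_antisymm`), every term `≥ 0` on the
  polytope (lit `SinusoidalCoupling.sector_nonneg`) and `= 0` only at `σᵢⱼ = σ*ᵢⱼ` (lit
  `SinusoidalCoupling.sector_pos_of_abs_add_lt` — «if V̇(x) = 0, then δ_kj = δ*_kj or
  δ_kj = ±π − δ*_kj», the latter lying on the boundary of 𝒫 [cite: VuTuritsyn2016, Appendix 9.2]);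
  then `δ − δ₀` is constant along edges, hence everywhere (preconnected, model-2's `eq_of_reachable`),
  and the momentum pins the constant (`momentum_shift`, `Σ Dᵢ > 0`). Compared with the window
  version `StructurePreservingSublevel.eq_of_isSyncEquilibrium_of_momentum_eq` (p475876-era,
  monotonicity of `sin` on `[−π/2, π/2]`), NO phase-cohesive window on `δ` is needed.
* `eq_equilibrium_of_fderiv_eq_zero_vtPolytope` — **hypothesis (iii)** of the tree's
  Barbashin–Krasovskii–LaSalle theorem
  (`Literature.Analysis.ODE.sublevel_subset_regionOfAttraction_of_noCompleteTrajectory`,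
  [cite: RoucheHabetsLaloy1977, Ch. II Thm 1.3]): a global solution of the phase field from
  `vtPolytope ∩ constraintSet` along which `V̇ ≡ 0` is the rest point `(δ₀, 0)` (`V̇ = −Σ Dᵢδ̇ᵢ²`
  kills every angle velocity, the generator frequencies vanish identically, so do their rates; every
  bus is in balance; uniqueness above).

THREE COLUMNS: mathematics about the typed MODEL MV-3 (with `gen = univ`: the network-reduced
classical model with non-uniform damping, MV-2L, no infinite bus); no certificate data; no sentence
here says that any grid is stable. No definition, no named fact; standard axioms.
-/

noncomputable section

open Set Filter Topology Real Finset
open Summit.Ventures.GridStability.Models.StructurePreserving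
open Summit.Ventures.GridStability.Models.StructurePreserving.Params
open Literature.MathematicalPhysics.PowerSystems (SinusoidalCoupling.sector_nonneg
  SinusoidalCoupling.sector_pos_of_abs_add_lt)

namespace Summit.Ventures.GridStability.Lyapunov.StructurePreserving

variable {n : ℕ}

/-! ### Uniqueness of the synchronous equilibrium inside the polytope on its momentum leaf -/

/-- **Inside Vu–Turitsyn's polytope the synchronous equilibrium is unique on its momentum leaf.**
Well-formed susceptive data, preconnected coupling graph, `n ≠ 0`; if `δ₀` (coupled line angles
`|σ*| < π/2`) and `δ` (coupled line angles with `|σ + σ*| < π`) are both synchronous equilibria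
(`fᵢ(δ) = P̄ᵢ = fᵢ(δ₀)`) with `L(δ, 0) = L(δ₀, 0)`, then `δ = δ₀`. Proof:
`0 = Σᵢ (δᵢ − δ₀ᵢ)(fᵢ(δ) − fᵢ(δ₀)) = ½ Σᵢⱼ bᵢⱼ (σᵢⱼ − σ*ᵢⱼ)(sin σᵢⱼ − sin σ*ᵢⱼ)` (model-2's
`half_sum_sub_mul_antisymm`); on the polytope every term is `≥ 0` (lit `sector_nonneg`) and vanishes
only for `σᵢⱼ = σ*ᵢⱼ` (lit `sector_pos_of_abs_add_lt` — «δ* is the only stationary point inside 𝒫»);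
so `δ − δ₀` is constant on edges, hence everywhere (preconnected), and the momentum pins the
constant to `0`. [cite: VuTuritsyn2016, Appendix 9.2] -/
theorem eq_of_isSyncEquilibrium_of_momentum_eq_vtPolytope {p : Params n} (hp : p.WellFormed)
    (hn : n ≠ 0) (hconn : p.couplingGraph.Preconnected) (hb : ∀ i j, 0 ≤ p.b i j)
    {δ₀ δ : Fin n → ℝ} (h0 : ∀ i j, p.b i j ≠ 0 → |δ₀ i - δ₀ j| < π / 2)
    (hP : ∀ i j, p.b i j ≠ 0 → |(δ i - δ j) + (δ₀ i - δ₀ j)| < π)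
    (hδ₀ : p.IsSyncEquilibrium δ₀) (hδ : p.IsSyncEquilibrium δ)
    (hL : p.momentum δ 0 = p.momentum δ₀ 0) : δ = δ₀ := by
  set φ : Fin n → ℝ := fun i => δ i - δ₀ i with hφ
  set A : Fin n → Fin n → ℝ := fun i j => Real.sin (δ i - δ j) - Real.sin (δ₀ i - δ₀ j) with hA
  have hanti : ∀ i j, A j i = -A i j := fun i j => by
    simp only [hA]
    rw [← neg_sub (δ i) (δ j), ← neg_sub (δ₀ i) (δ₀ j), Real.sin_neg, Real.sin_neg]
    ring
  -- Σᵢ φᵢ Σⱼ bᵢⱼ Aᵢⱼ = Σᵢ φᵢ (fᵢ(δ) − fᵢ(δ₀)) = 0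
  have hrow : ∀ i, ∑ j, p.b i j * A i j = p.pe δ i - p.pe δ₀ i := fun i => by
    simp only [hA, Params.pe, ← Finset.sum_sub_distrib]
    exact Finset.sum_congr rfl fun j _ => by ring
  have hzero : ∑ i, φ i * ∑ j, p.b i j * A i j = 0 :=
    Finset.sum_eq_zero fun i _ => by rw [hrow i, hδ i, hδ₀ i, sub_self, mul_zero]
  have hhalf := half_sum_sub_mul_antisymm p.b A φ hp.b_symm hanti
  rw [hzero] at hhalf
  -- every term is nonnegative on the polytope
  have hφA : ∀ i j, (φ i - φ j) * A i j = ((δ i - δ j) - (δ₀ i - δ₀ j))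
      * (Real.sin (δ i - δ j) - Real.sin (δ₀ i - δ₀ j)) := fun i j => by
    simp only [hφ, hA]
    ring
  have hterm : ∀ i j, 0 ≤ p.b i j * ((φ i - φ j) * A i j) := by
    intro i j
    by_cases hij : p.b i j = 0
    · rw [hij, zero_mul]
    · rw [hφA]
      exact mul_nonneg (hb i j)
        (SinusoidalCoupling.sector_nonneg (h0 i j hij).le (hP i j hij).le)
  -- hence every coupled term vanishes: σᵢⱼ = σ*ᵢⱼ on edges
  have hsum0 : ∑ i, ∑ j, p.b i j * ((φ i - φ j) * A i j) = 0 := by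
    have h2 : (1 / 2 : ℝ) ≠ 0 := by norm_num
    exact (mul_eq_zero.1 hhalf).resolve_left h2
  have hedge : ∀ i j, p.couplingGraph.Adj i j → φ i = φ j := by
    intro i j hij
    have hbij : p.b i j ≠ 0 := ((p.couplingGraph_adj_of_symm hp.b_symm i j).1 hij).2
    have h1 := (Finset.sum_eq_zero_iff_of_nonneg fun i _ =>
      Finset.sum_nonneg fun j _ => hterm i j).1 hsum0 i (Finset.mem_univ i)
    have h2 := (Finset.sum_eq_zero_iff_of_nonneg fun j _ => hterm i j).1 h1 j (Finset.mem_univ j)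
    have h3 : (φ i - φ j) * A i j = 0 := (mul_eq_zero.1 h2).resolve_left hbij
    by_contra hne
    have hne' : δ i - δ j ≠ δ₀ i - δ₀ j := by
      intro h
      apply hne
      simp only [hφ]
      linarith
    have hpos := SinusoidalCoupling.sector_pos_of_abs_add_lt (h0 i j hbij) (hP i j hbij) hne'
    rw [hφA] at h3
    exact absurd h3 hpos.ne'
  -- preconnected: φ is constant; the momentum pins the constant
  obtain ⟨k, hk⟩ := Nat.exists_eq_succ_of_ne_zero hn
  subst hk
  have hconst : ∀ i, φ i = φ 0 := fun i => p.eq_of_reachable hedge (hconn i 0)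
  have hshift : δ = fun i => δ₀ i + φ 0 := by
    funext i
    have := hconst i
    simp only [hφ] at this
    linarith
  have hLs : p.momentum δ 0 = p.momentum δ₀ 0 + φ 0 * ∑ i, p.D i := by
    rw [hshift]
    exact p.momentum_shift δ₀ 0 (φ 0)
  have hc : φ 0 * ∑ i, p.D i = 0 := by linarith
  have hc0 : φ 0 = 0 := (mul_eq_zero.1 hc).resolve_right (sum_D_pos hp (Nat.succ_ne_zero k)).ne'
  rw [hshift, hc0]
  funext i
  simp

/-- **Hypothesis (iii) of Barbashin–Krasovskii on the polytope: a global solution from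
`vtPolytope ∩ constraintSet` along which `V̇ ≡ 0` is the rest point `(δ₀, 0)`.** Along such a
solution every angle velocity vanishes (`V̇ = −Σ Dᵢ δ̇ᵢ²`), so the generator frequencies vanish
identically, hence so do their rates (uniqueness of the one-sided derivative on `[0, 1]`): every bus
is in power balance at `t = 0`, i.e. the initial angle vector is a synchronous equilibrium INSIDE THE
POLYTOPE on the momentum leaf of `δ₀` — which is `δ₀`
(`eq_of_isSyncEquilibrium_of_momentum_eq_vtPolytope`). [cite: RoucheHabetsLaloy1977, Ch. II Thm 1.3 (hypothesis (iii))] -/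
theorem eq_equilibrium_of_fderiv_eq_zero_vtPolytope {p : Params n} (hp : p.WellFormed) (hn : n ≠ 0)
    (hconn : p.couplingGraph.Preconnected) (hb : ∀ i j, 0 ≤ p.b i j)
    {δ₀ : Fin n → ℝ} (h0 : ∀ i j, p.b i j ≠ 0 → |δ₀ i - δ₀ j| < π / 2)
    (hδ₀ : p.IsSyncEquilibrium δ₀)
    {Y : ℝ → (Fin n → ℝ) × (Fin n → ℝ)} (hY0 : Y 0 ∈ vtPolytope p δ₀ ∩ constraintSet p δ₀)
    (hY : ∀ T : ℝ, ∀ t ∈ Icc 0 T, HasDerivWithinAt Y (phaseField p (Y t)) (Icc 0 T) t)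
    (hzero : ∀ t, 0 ≤ t → fderiv ℝ (phaseEnergy p δ₀) (Y t) (phaseField p (Y t)) = 0) :
    Y 0 = (δ₀, 0) := by
  -- all angle velocities vanish along `Y`
  have hF1 : ∀ t, 0 ≤ t → ∀ i, (phaseField p (Y t)).1 i = 0 := fun t ht i =>
    phaseField_fst_eq_zero_of_fderiv_eq_zero hp hδ₀ (hzero t ht) i
  -- so the generator frequencies vanish identically
  have hω : ∀ t, 0 ≤ t → ∀ i ∈ p.gen, (Y t).2 i = 0 := fun t ht i hi => by
    rw [← phaseField_fst_of_mem p (Y t) hi]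
    exact hF1 t ht i
  -- hence the generator frequency RATES vanish at `t = 0`
  have hF2 : ∀ i ∈ p.gen, (phaseField p (Y 0)).2 i = 0 := fun i hi => by
    set π₂ : ((Fin n → ℝ) × (Fin n → ℝ)) →L[ℝ] ℝ :=
      (ContinuousLinearMap.proj i).comp (ContinuousLinearMap.snd ℝ (Fin n → ℝ) (Fin n → ℝ))
      with hπ₂
    have hπ : ∀ x : (Fin n → ℝ) × (Fin n → ℝ), π₂ x = x.2 i := fun x => rfl
    have h1 : HasDerivWithinAt (⇑π₂ ∘ Y) (π₂ (phaseField p (Y 0))) (Icc 0 1) 0 :=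
      π₂.hasFDerivAt.comp_hasDerivWithinAt (0 : ℝ) (hY 1 0 ⟨le_rfl, zero_le_one⟩)
    have h2 : HasDerivWithinAt (⇑π₂ ∘ Y) 0 (Icc 0 1) 0 :=
      ((hasDerivAt_const (0 : ℝ) (0 : ℝ)).hasDerivWithinAt (s := Icc 0 1)).congr
        (fun s hs => by
          show π₂ (Y s) = 0
          rw [hπ]
          exact hω s hs.1 i hi)
        (by
          show π₂ (Y 0) = 0
          rw [hπ]
          exact hω 0 le_rfl i hi)
    have h := (uniqueDiffOn_Icc_zero_one 0 ⟨le_rfl, zero_le_one⟩).eq_deriv _ h1 h2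
    rwa [hπ] at h
  -- every bus is in power balance at `(Y 0).1`
  have hpe : p.IsSyncEquilibrium (Y 0).1 := fun i => by
    by_cases hi : i ∈ p.gen
    · have h := hF2 i hi
      rw [phaseField_snd_of_mem p (Y 0) hi, hω 0 le_rfl i hi, mul_zero, sub_zero] at h
      rcases div_eq_zero_iff.1 h with h | h
      · linarith
      · exact absurd h (hp.M_pos i hi).ne'
    · have h := hF1 0 le_rfl i
      rw [phaseField_fst_of_not_mem p (Y 0) hi] at h
      rcases div_eq_zero_iff.1 h with h | h
      · linarith
      · exact absurd h (hp.D_pos i).ne'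
  -- all frequency coordinates vanish at `t = 0`
  have hY2 : (Y 0).2 = 0 := funext fun i => by
    by_cases hi : i ∈ p.gen
    · exact hω 0 le_rfl i hi
    · exact hY0.2.2 i hi
  have hL : p.momentum (Y 0).1 0 = p.momentum δ₀ 0 := by
    have h := hY0.2.1
    rwa [hY2] at h
  have hδ := eq_of_isSyncEquilibrium_of_momentum_eq_vtPolytope hp hn hconn hb h0 hY0.1 hδ₀ hpe hL
  exact Prod.ext hδ hY2

end Summit.Ventures.GridStability.Lyapunov.StructurePreserving

end
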